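import Mathlib
import Literature.NumberTheory.Sieve.Maynard2016GPYReduction
import HarnessLib

/-!
# Maynard 2016, §§4–8: the GPY sieve weights and the three sieve estimates (Lemmas 6, 7, 8), typed

Topic `Literature/NumberTheory/Sieve`. J. Maynard, *Large gaps between primes*, Ann. of Math. (2)
183 (2016), 915–933 = arXiv:1408.5110 (page and display numbers below refer to the arXiv text,
whose lemmas are numbered consecutively: Lemma 2, 3, 4, Proposition 5, Lemma 6, 7, 8).

After `Maynard2016Lemma2Proof`, `Maynard2016Lemma3Proof`, `Maynard2016Lemma4Proof`,
`Maynard2016ReductionProof`, `Maynard2016Prop5Equivalence` and `Maynard2016Theorem1OfGPY`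
(`theorem1_of_GPYMeasures_holds : GPYMeasures → Maynard2016_theorem1`), the named fact
`GPYMeasures` (§4, first paragraph: probability measures `μ_{m,q}` with `Σ_q μ_{m,q}(p) ≥ t` for
almost all `p ∈ 𝓡_m`) is the only input of Maynard's Theorem 1 not yet in the tree. This file
TYPES, verbatim from §§4–8, the objects and the three lemmas from which §8 (last paragraph)
assembles it:

* §4, display (4.1) and §5, displays (5.1)–(5.5): the parameter `w = log₄ x` (`wFun`; "we could
  take `w = log₄ x`, for example"), `P_w = ∏_{p ≤ w} p`, the admissible tuple
  `h_j = p_{π(k)+j} P_w` (`hTuple`), the smooth data `(J, c_j, F_{ℓ,j}, G)` of (5.3)–(5.4)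
  (`IsSieveData`: `c_j > 0`; `F_{ℓ,j}, G` smooth, non-negative, not identically zero on `[0, ∞)`;
  `sup{Σ_ℓ u_ℓ : F_{ℓ,j}(u_ℓ) ≠ 0 ∀ ℓ} ≤ 1/10`; `G` supported on `[0, 1]`), the coefficients
  `λ_{d,e}` (5.3) (`lam`), the divisor sums and the un-normalised / normalised measures of (4.1)
  (`divSum`, `baseSet`, `normInv = α_{m,q}⁻¹`, `classSum`, `gpyMeasure = μ_{m,q}`), the local
  densities `ω_{m,q}(p)` (5.1) and the singular series `𝔖_{m,q}` (5.2) (`omegaMQ`, `singSeriesMQ`),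
  the function `F = Σ_j c_j ∏_ℓ F'_{ℓ,j}` (5.5) (`Fsum`) and the four functionals
  `I_k^{(1)}(F)`, `I_k^{(2)}(G)` (Lemma 6) and `J_k^{(1)}(F)`, `J_k^{(2)}(G)` (Lemma 7)
  (`I1`, `I2`, `J1`, `J2`).
* `Lemma6` — Lemma 6 (p. 9): `α_{m,q}⁻¹ = (1 + o_k(1)) U 𝔖_{m,q} I^{(1)} I^{(2)} / (m (log x)^k (log y)^k)`.
* `Lemma7` — Lemma 7 (p. 11): for even `m < U z⁻¹ (log₂ x)⁻²` and `p₀ ∈ 𝓡_m` with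
  `h_k x < p₀ < U/m − h_k x`,
  `Σ_{q ∈ 𝓘_m} μ_{m,q}(p₀) ≫ (1 + o_k(1)) k |𝓘_m| J^{(1)} J^{(2)} / ((log x) |𝓡_m| I^{(1)} I^{(2)})`.
* `Lemma8` — Lemma 8 (p. 13, "the key integral estimate from [Maynard 2015]"): a choice of the
  smooth data with `k J^{(1)} J^{(2)} / (I^{(1)} I^{(2)}) ≫ log k`.

All three are NAMED FACTS (`def … : Prop`), not proved here; the deduction
`Lemma7 → Lemma8 → GPYMeasures` (§8, last paragraph, with Lemma 3 for the two end ranges of `p₀`)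
is the subject of a companion file.

## Typing decisions (all conservative; each is flagged at the declaration)

* **Symmetry.** Maynard assumes the `F_{ℓ,j}` are chosen so that `F` is symmetric and states
  Lemma 7 with `k J_k^{(1)}(F)`; symmetry is used only to identify the `k` functionals
  `J^{(1),i}` (inner integration in the `i`-th variable). We do not impose symmetry and state
  Lemma 7 / Lemma 8 with `Σ_i J^{(1),i}(F)` in place of `k J^{(1)}(F)` (equal for symmetric `F`),
  exactly as Maynard 2015, Prop. 4.1 carries `Σ_m J_k^{(m)}`.
* **Smoothness on `[0, ∞)`.** "smooth functions `F_{i,j}, G : [0, ∞) → ℝ`" are typed as `C^∞`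
  functions on `ℝ` (any smooth function on the closed half-line extends); only their values on
  `[0, ∞)` enter the weights and the functionals. In particular `G(0) ≠ 0` is allowed (needed for
  `J^{(2)} = G(0)² (∫ G'²)^{k−1} > 0`).
* **Positivity side conditions.** Lemmas 6 and 7 are relative-error statements about a main term
  proportional to `I^{(1)}(F) I^{(2)}(G)`; we add the hypotheses `0 < I^{(1)}`, `0 < I^{(2)}`
  (supplied by Lemma 8, whose typed form asserts them) rather than derive them from
  "not identically zero".
* **Quantifiers.** "`o_k(1)`" (`x → ∞` with `k`, the data, `ε`, `δ`, `C_U` fixed) is typed as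
  `∀ κ > 0, ∀ᶠ x`, with `k` and the data quantified inside `∀ᶠ ε in 𝓝[>] 0` (the smallness of
  `ε` required in §§6–7 does not depend on `k`); the implied constant of "`≫`" in Lemma 7
  (absolute in the source) is typed as a `c > 0` chosen after `C_U` and `ε` but before `k`, the
  data and `δ` (independence of `k` is what the deduction "`≫ δ log k`, then choose `k` large" on
  p. 13 requires); the
  range of `m` is that of Proposition 5 / `GPYMeasures`, `m < U z⁻¹ (log₂ x)⁻²` (the display of
  Lemma 7 prints `(log x)⁻²`, its proof and the final paragraph of §8 use `(log₂ x)⁻²`); the interval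
  `𝓘_m = [A, B] ⊆ [x/2, x]` has length `≥ δ |𝓡_m| log x` as in `GPYMeasures`, and `|𝓘_m| = B − A`.
* **`J^{(1),i}` as a `k`-fold integral.** As for `maynardJ` (`MaynardTao.lean`), `J^{(1),i}` is
  written as an integral over `k` variables with the dummy variable `t_i ∈ [0, 1]` (the integrand
  does not depend on `t_i`, the fibre has measure `1`).

## References

* J. Maynard, *Large gaps between primes*, Ann. of Math. (2) 183 (2016), 915–933; arXiv:1408.5110,
  §4 display (4.1), §5 displays (5.1)–(5.5), §6 Lemmas 6 and 7, §8 Lemma 8 and the final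
  paragraph. [Maynard2016LargeGaps]
* J. Maynard, *Small gaps between primes*, Ann. of Math. (2) 181 (2015), 383–413 (the functionals
  `I_k`, `J_k^{(m)}` and the choice of `F_k` quoted in Lemma 8). [Maynard2015]
-/

open Filter Finset MeasureTheory
open scoped Topology ContDiff

namespace Literature.NumberTheory.Sieve

namespace Maynard2016

/-! ### §4–§5: parameters, tuple, smooth data -/

/-- `w = log₄ x` (§4, p. 7: "`w` is a quantity which will go to infinity slowly with `x`, such that
`P_w = o(log₂ x)` (we could take `w = log₄ x`, for example)"). [cite: Maynard2016LargeGaps, §4 (choice of w)] -/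
noncomputable def wFun (x : ℕ) : ℝ := Real.log (Real.log (Real.log (Real.log x)))

/-- `P_w = ∏_{p ≤ w} p`, "all primes less than `w`" multiplied together (§4, p. 7), as
`primorial ⌊w⌋`. [cite: Maynard2016LargeGaps, §4 (definition of h_j)] -/
noncomputable def Pw (x : ℕ) : ℕ := primorial ⌊wFun x⌋₊

/-- The admissible tuple `𝓗 = {h_1, …, h_k}`, `h_j = p_{π(k)+j} P_w` ("`h_j` is the `j`-th prime
greater than `k`, multiplied by all primes less than `w`", §4, p. 7); indexed by `i : Fin k`,
`hTuple k x i = h_{i+1} = (Nat.nth Nat.Prime (π(k) + i)) · P_w`. [cite: Maynard2016LargeGaps, §4 (definition of h_j)] -/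
noncomputable def hTuple (k x : ℕ) (i : Fin k) : ℕ :=
  Nat.nth Nat.Prime (Nat.primeCounting k + i) * Pw x

/-- The smooth data of §5, display (5.3)–(5.4): positive constants `c_j` (`j ≤ J`), smooth
non-negative functions `F_{ℓ,j}, G : [0, ∞) → ℝ` which are not identically zero, with
`sup{Σ_ℓ u_ℓ : F_{ℓ,j}(u_ℓ) ≠ 0 for all ℓ} ≤ 1/10` for each `j` and `G` supported on `[0, 1]`
(typed as `C^∞` functions on `ℝ`, see the module docstring; the symmetry of `F` assumed in the
source is not imposed). [cite: Maynard2016LargeGaps, §5 displays (5.3)–(5.4)] -/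
structure IsSieveData (k J : ℕ) (c : Fin J → ℝ) (Fd : Fin k → Fin J → ℝ → ℝ) (G : ℝ → ℝ) :
    Prop where
  /-- `c_j > 0`. -/
  c_pos : ∀ j, 0 < c j
  /-- each `F_{ℓ,j}` is smooth. -/
  Fd_smooth : ∀ ℓ j, ContDiff ℝ ∞ (Fd ℓ j)
  /-- each `F_{ℓ,j}` is non-negative. -/
  Fd_nonneg : ∀ ℓ j u, 0 ≤ Fd ℓ j u
  /-- each `F_{ℓ,j}` is not identically zero on `[0, ∞)`. -/
  Fd_ne_zero : ∀ ℓ j, ∃ u, 0 ≤ u ∧ Fd ℓ j u ≠ 0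
  /-- display (5.4): `sup{Σ_ℓ u_ℓ : F_{ℓ,j}(u_ℓ) ≠ 0 ∀ ℓ} ≤ 1/10`. -/
  Fd_support : ∀ j (u : Fin k → ℝ), (∀ ℓ, 0 ≤ u ℓ) → (∀ ℓ, Fd ℓ j (u ℓ) ≠ 0) →
    ∑ ℓ, u ℓ ≤ 1 / 10
  /-- `G` is smooth. -/
  G_smooth : ContDiff ℝ ∞ G
  /-- `G` is non-negative. -/
  G_nonneg : ∀ u, 0 ≤ G u
  /-- `G` is not identically zero on `[0, ∞)`. -/
  G_ne_zero : ∃ u, 0 ≤ u ∧ G u ≠ 0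
  /-- `G` is supported on `[0, 1]`. -/
  G_support : ∀ u, 1 < u → G u = 0

/-- `λ_{d_1,…,d_k,e_1,…,e_k} = (∏_i μ(d_i) μ(e_i)) Σ_j c_j ∏_ℓ F_{ℓ,j}(log d_ℓ / log x) G(log e_ℓ / log y)`
(§5, display (5.3)). [cite: Maynard2016LargeGaps, §5 display (5.3)] -/
noncomputable def lam {k J : ℕ} (c : Fin J → ℝ) (Fd : Fin k → Fin J → ℝ → ℝ) (G : ℝ → ℝ)
    (ε : ℝ) (x : ℕ) (d e : Fin k → ℕ) : ℝ :=
  (∏ i, ((ArithmeticFunction.moebius (d i) : ℤ) : ℝ) * ((ArithmeticFunction.moebius (e i) : ℤ) : ℝ)) *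
    ∑ j, c j * ∏ ℓ, Fd ℓ j (Real.log (d ℓ) / Real.log x) * G (Real.log (e ℓ) / Real.log (y ε x))

/-- The divisor sum inside (4.1):
`Σ_{d_1,…,d_k : d_i ∣ n + h_i q} Σ_{e_1,…,e_k : e_i ∣ m(n + h_i q) − 1} λ_{d,e}`. [cite: Maynard2016LargeGaps, §4 display (4.1)] -/
noncomputable def divSum {k J : ℕ} (c : Fin J → ℝ) (Fd : Fin k → Fin J → ℝ → ℝ) (G : ℝ → ℝ)
    (ε : ℝ) (x m q n : ℕ) : ℝ :=
  ∑ d ∈ Fintype.piFinset (fun i : Fin k => (n + hTuple k x i * q).divisors),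
    ∑ e ∈ Fintype.piFinset (fun i : Fin k => (m * (n + hTuple k x i * q) - 1).divisors),
      lam c Fd G ε x d e

/-- The range of `n` in (4.1): `n ≤ U/m` with `(n(mn − 1), P_w) = 1`. [cite: Maynard2016LargeGaps, §4 display (4.1)] -/
noncomputable def baseSet (C_U ε : ℝ) (x m : ℕ) : Finset ℕ :=
  (Finset.Icc 1 ⌊U C_U ε x / m⌋₊).filter (fun n => Nat.Coprime (n * (m * n - 1)) (Pw x))

/-- `α_{m,q}⁻¹ = Σ_{n ≤ U/m, (n(mn−1),P_w)=1} (divisor sum)²`, the normalising sum of (4.1)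
(display (6.1)). [cite: Maynard2016LargeGaps, §6 display (6.1)] -/
noncomputable def normInv {k J : ℕ} (c : Fin J → ℝ) (Fd : Fin k → Fin J → ℝ → ℝ) (G : ℝ → ℝ)
    (C_U ε : ℝ) (x m q : ℕ) : ℝ :=
  ∑ n ∈ baseSet C_U ε x m, divSum c Fd G ε x m q n ^ 2

/-- The un-normalised mass of the class `a (mod q)` in (4.1): the same sum restricted to
`n ≡ a (mod q)` (for `a < q`: `n % q = a`). [cite: Maynard2016LargeGaps, §4 display (4.1)] -/
noncomputable def classSum {k J : ℕ} (c : Fin J → ℝ) (Fd : Fin k → Fin J → ℝ → ℝ) (G : ℝ → ℝ)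
    (C_U ε : ℝ) (x m q a : ℕ) : ℝ :=
  ∑ n ∈ (baseSet C_U ε x m).filter (fun n => n % q = a), divSum c Fd G ε x m q n ^ 2

/-- The GPY probability `μ_{m,q}(a) = α_{m,q} Σ_{n ≤ U/m, n ≡ a (q), (n(mn−1),P_w)=1} (divisor sum)²`
of §4, display (4.1) (junk value `0` if the normalising sum vanishes). [cite: Maynard2016LargeGaps, §4 display (4.1)] -/
noncomputable def gpyMeasure {k J : ℕ} (c : Fin J → ℝ) (Fd : Fin k → Fin J → ℝ → ℝ) (G : ℝ → ℝ)
    (C_U ε : ℝ) (x m q a : ℕ) : ℝ :=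
  classSum c Fd G C_U ε x m q a / normInv c Fd G C_U ε x m q

/-- `ω_{m,q}(p) = #{1 ≤ n ≤ p : n + h_i q ≡ 0 or m(n + h_i q) ≡ 1 (mod p) for some i}`
(§5, display (5.1)). [cite: Maynard2016LargeGaps, §5 display (5.1)] -/
noncomputable def omegaMQ (k x m q p : ℕ) : ℕ :=
  ((Finset.Icc 1 p).filter (fun n => ∃ i : Fin k,
      p ∣ n + hTuple k x i * q ∨ m * (n + hTuple k x i * q) ≡ 1 [MOD p])).card

/-- `𝔖_{m,q} = ∏_{p ≤ y} (1 − ω_{m,q}(p)/p) (1 − 1/p)^{−2k}` (§5, display (5.2)). [cite: Maynard2016LargeGaps, §5 display (5.2)] -/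
noncomputable def singSeriesMQ (k : ℕ) (ε : ℝ) (x m q : ℕ) : ℝ :=
  ∏ p ∈ (Finset.Iic ⌊y ε x⌋₊).filter Nat.Prime,
    (1 - (omegaMQ k x m q p : ℝ) / p) * ((1 - 1 / (p : ℝ)) ^ (2 * k))⁻¹

/-! ### The function `F` of (5.5) and the functionals of Lemmas 6 and 7 -/

/-- `F(t_1,…,t_k) = Σ_j c_j ∏_ℓ F'_{ℓ,j}(t_ℓ)` (§5, display (5.5)). [cite: Maynard2016LargeGaps, §5 display (5.5)] -/
noncomputable def Fsum {k J : ℕ} (c : Fin J → ℝ) (Fd : Fin k → Fin J → ℝ → ℝ)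
    (t : Fin k → ℝ) : ℝ :=
  ∑ j, c j * ∏ ℓ, deriv (Fd ℓ j) (t ℓ)

/-- `I_k^{(1)}(F) = ∫_{t_1,…,t_k ≥ 0} F(t)² dt` (Lemma 6). [cite: Maynard2016LargeGaps, Lemma 6 (definition of I^(1))] -/
noncomputable def I1 {k J : ℕ} (c : Fin J → ℝ) (Fd : Fin k → Fin J → ℝ → ℝ) : ℝ :=
  ∫ t in Set.univ.pi (fun _ : Fin k => Set.Ici (0 : ℝ)), Fsum c Fd t ^ 2

/-- `I_k^{(2)}(G) = (∫_0^∞ G'(u)² du)^k` (Lemma 6). [cite: Maynard2016LargeGaps, Lemma 6 (definition of I^(2))] -/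
noncomputable def I2 (k : ℕ) (G : ℝ → ℝ) : ℝ :=
  (∫ u in Set.Ioi (0 : ℝ), deriv G u ^ 2) ^ k

/-- `J_k^{(1),i}(F) = ∫_{t_ℓ ≥ 0 (ℓ ≠ i)} (∫_{u ≥ 0} F(t with t_i := u) du)² ∏_{ℓ ≠ i} dt_ℓ` (Lemma 7,
where the source integrates out the last variable and uses the symmetry of `F`); implemented as a
`k`-fold integral with the dummy variable `t_i ∈ [0, 1]`. [cite: Maynard2016LargeGaps, Lemma 7 (definition of J^(1))] -/
noncomputable def J1 {k J : ℕ} (c : Fin J → ℝ) (Fd : Fin k → Fin J → ℝ → ℝ) (i : Fin k) : ℝ :=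
  ∫ t in Set.univ.pi (fun ℓ : Fin k => if ℓ = i then Set.Icc (0 : ℝ) 1 else Set.Ici 0),
    (∫ u in Set.Ioi (0 : ℝ), Fsum c Fd (Function.update t i u)) ^ 2

/-- `J_k^{(2)}(G) = G(0)² (∫_0^∞ G'(u)² du)^{k−1}` (Lemma 7). [cite: Maynard2016LargeGaps, Lemma 7 (definition of J^(2))] -/
noncomputable def J2 (k : ℕ) (G : ℝ → ℝ) : ℝ :=
  G 0 ^ 2 * (∫ u in Set.Ioi (0 : ℝ), deriv G u ^ 2) ^ (k - 1)

/-! ### Lemmas 6, 7, 8 as named facts -/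

/-- **Maynard 2016, Lemma 6** (§6, p. 9): for fixed `k` and smooth data,
`α_{m,q}⁻¹ = (1 + o_k(1)) U 𝔖_{m,q} I_k^{(1)}(F) I_k^{(2)}(G) / (m (log x)^k (log y)^k)` as
`x → ∞`, for even `m < U z⁻¹ (log₂ x)⁻²` and primes `q ∈ [x/2, x]` (typed with the positivity of
`I^{(1)}, I^{(2)}` as hypotheses, see the module docstring). Named fact, not proved here (the
Fourier-analytic evaluation, displays (6.1)–(6.20)). [cite: Maynard2016LargeGaps, Lemma 6] -/
def Lemma6 : Prop :=
  ∀ C_U : ℝ, 0 < C_U → ∀ᶠ ε : ℝ in 𝓝[>] 0, ∀ k : ℕ, 1 ≤ k →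
    ∀ (J : ℕ) (c : Fin J → ℝ) (Fd : Fin k → Fin J → ℝ → ℝ) (G : ℝ → ℝ),
      IsSieveData k J c Fd G → 0 < I1 c Fd → 0 < I2 k G → ∀ κ : ℝ, 0 < κ →
        ∀ᶠ x : ℕ in atTop,
          ∀ m : ℕ, 1 ≤ m → Even m → (m : ℝ) < U C_U ε x / (z x * (Real.log (Real.log x)) ^ 2) →
            ∀ q : ℕ, q.Prime → (x : ℝ) / 2 ≤ q → (q : ℝ) ≤ x →
              |normInv c Fd G C_U ε x m q -
                  U C_U ε x * singSeriesMQ k ε x m q * I1 c Fd * I2 k G /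
                    (m * (Real.log x) ^ k * (Real.log (y ε x)) ^ k)| ≤
                κ * (U C_U ε x * singSeriesMQ k ε x m q * I1 c Fd * I2 k G /
                    (m * (Real.log x) ^ k * (Real.log (y ε x)) ^ k))

/-- **Maynard 2016, Lemma 7** (§6, p. 11): there is a constant `c > 0` (absolute in the source;
typed, more weakly, as allowed to depend on `C_U` and `ε` but not on `k`, the data or `δ`) such
that, for fixed `k ≥ 2`, smooth data and `δ > 0`, for all large `x`, every even `m < U z⁻¹ (log₂ x)⁻²`, every
interval `𝓘_m = [A, B] ⊆ [x/2, x]` of length `≥ δ |𝓡_m| log x` and every `p₀ ∈ 𝓡_m` with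
`h_i x < p₀ < U/m − h_i x` for all `i`:
`Σ_{q ∈ 𝓘_m prime} μ_{m,q}(p₀) ≥ (1 − κ) c (B − A) (Σ_i J_k^{(1),i}(F)) J_k^{(2)}(G) / ((log x) |𝓡_m| I_k^{(1)}(F) I_k^{(2)}(G))`
(`Σ_i J^{(1),i} = k J^{(1)}` for the symmetric `F` of the source). Named fact, not proved here
(displays (6.21)–(6.31): positivity, the terms `n = p₀ − h q`, Bombieri–Vinogradov for the primes
`q` of `𝓘_m` in arithmetic progressions, and the evaluation of Lemma 6). [cite: Maynard2016LargeGaps, Lemma 7] -/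
def Lemma7 : Prop :=
  ∀ C_U : ℝ, 0 < C_U → ∀ᶠ ε : ℝ in 𝓝[>] 0, ∃ c : ℝ, 0 < c ∧ ∀ k : ℕ, 2 ≤ k →
    ∀ (J : ℕ) (cj : Fin J → ℝ) (Fd : Fin k → Fin J → ℝ → ℝ) (G : ℝ → ℝ),
      IsSieveData k J cj Fd G → 0 < I1 cj Fd → 0 < I2 k G → ∀ δ : ℝ, 0 < δ → ∀ κ : ℝ, 0 < κ →
        ∀ᶠ x : ℕ in atTop,
          ∀ m : ℕ, 1 ≤ m → Even m → (m : ℝ) < U C_U ε x / (z x * (Real.log (Real.log x)) ^ 2) →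
            ∀ A B : ℝ, (x : ℝ) / 2 ≤ A → B ≤ x →
              δ * (Rm C_U ε x m).card * Real.log x ≤ B - A →
                ∀ p₀ ∈ Rm C_U ε x m,
                  (∀ i : Fin k, (hTuple k x i : ℝ) * x < p₀ ∧
                      (p₀ : ℝ) < U C_U ε x / m - hTuple k x i * x) →
                    (1 - κ) * c * ((B - A) * (∑ i, J1 cj Fd i) * J2 k G) /
                        (Real.log x * (Rm C_U ε x m).card * I1 cj Fd * I2 k G) ≤
                      ∑ q ∈ intervalPrimes A B, gpyMeasure cj Fd G C_U ε x m q (p₀ % q)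

/-- **Maynard 2016, Lemma 8** (§8, p. 13; "the key integral estimate from [Maynard 2015]"): there is
an absolute `c > 0` such that for all large `k` there is a choice of the smooth data (5.3)–(5.4) with
`(Σ_i J_k^{(1),i}(F)) J_k^{(2)}(G) ≥ c (log k) I_k^{(1)}(F) I_k^{(2)}(G)` and `I^{(1)}, I^{(2)} > 0`
(source: `k J^{(1)} J^{(2)} / (I^{(1)} I^{(2)}) ≫ log k` for a symmetric `F`; `c` independent of `k`; proof there: `G` a
smooth approximation to `1 − t`, `F` a smooth approximation to `F_k(10 t)` with Maynard 2015's
`F_k = ∏ g(k tᵢ)`, `g(t) = 1/(1 + A t)` on `[0, T]`). Named fact, not proved here. [cite: Maynard2016LargeGaps, Lemma 8] -/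
def Lemma8 : Prop :=
  ∃ c : ℝ, 0 < c ∧ ∃ k₀ : ℕ, ∀ k : ℕ, k₀ ≤ k →
    ∃ (J : ℕ) (cj : Fin J → ℝ) (Fd : Fin k → Fin J → ℝ → ℝ) (G : ℝ → ℝ),
      IsSieveData k J cj Fd G ∧ 0 < I1 cj Fd ∧ 0 < I2 k G ∧
        c * Real.log k * (I1 cj Fd * I2 k G) ≤ (∑ i, J1 cj Fd i) * J2 k G

/-! ### Elementary properties of the measures (used by the assembly of `GPYMeasures`) -/

/-- `μ_{m,q}(a) ≥ 0`. [cite: Maynard2016LargeGaps, §4 display (4.1)] -/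
theorem gpyMeasure_nonneg {k J : ℕ} (c : Fin J → ℝ) (Fd : Fin k → Fin J → ℝ → ℝ) (G : ℝ → ℝ)
    (C_U ε : ℝ) (x m q a : ℕ) : 0 ≤ gpyMeasure c Fd G C_U ε x m q a := by
  unfold gpyMeasure classSum normInv
  exact div_nonneg (sum_nonneg fun _ _ => sq_nonneg _) (sum_nonneg fun _ _ => sq_nonneg _)

/-- `Σ_{a (mod q)}` of the class sums is the normalising sum `α_{m,q}⁻¹` (for `q ≥ 1`).
[cite: Maynard2016LargeGaps, §4 («α_{m,q} is a normalizing constant so that Σ_a μ_{m,q}(a) = 1»)] -/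
theorem sum_classSum_range {k J : ℕ} (c : Fin J → ℝ) (Fd : Fin k → Fin J → ℝ → ℝ) (G : ℝ → ℝ)
    (C_U ε : ℝ) (x m : ℕ) {q : ℕ} (hq : 0 < q) :
    ∑ a ∈ Finset.range q, classSum c Fd G C_U ε x m q a = normInv c Fd G C_U ε x m q := by
  unfold classSum normInv
  rw [Finset.sum_fiberwise_of_maps_to (g := fun n : ℕ => n % q)]
  intro n _
  exact Finset.mem_range.2 (Nat.mod_lt n hq)

/-- `Σ_{a (mod q)} μ_{m,q}(a) = 1` whenever the normalising sum is non-zero (`q ≥ 1`).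
[cite: Maynard2016LargeGaps, §4 («Σ_{a (mod q)} μ_{m,q}(a) = 1»)] -/
theorem sum_gpyMeasure_range {k J : ℕ} (c : Fin J → ℝ) (Fd : Fin k → Fin J → ℝ → ℝ) (G : ℝ → ℝ)
    (C_U ε : ℝ) (x m : ℕ) {q : ℕ} (hq : 0 < q) (h0 : normInv c Fd G C_U ε x m q ≠ 0) :
    ∑ a ∈ Finset.range q, gpyMeasure c Fd G C_U ε x m q a = 1 := by
  unfold gpyMeasure
  rw [← Finset.sum_div, sum_classSum_range c Fd G C_U ε x m hq, div_self h0]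

end Maynard2016

end Literature.NumberTheory.Sieve
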